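import Summits.HubbardSuperconductivity.HubbardSuperconductivity.Theorems.WidthHaldaneTubeEtaPairing

/-!
# The pair correlator of an `η`-lowest-weight state is the `η`-raised part of its current correlator

Support file for crux `WidthHaldaneBridge` (stmt-HubbardSuperconductivity-16311; routes
`WidthHaldane`, `SeamInduction`), line `IdeaSketchK2`, card `eta-lowest-weight`: it PROVES the
registered stub `stub_pairCorrAsRaisedCurrent` (the last declaration of this file, same statement).

With `η = etaLower ε` (Yang's lowering operator for the bipartite stagger `ε = (-1)^{a+b}` of the
even tube `ℤ/L × ℤ/M`), the column `d_{x²-y²}` pair field `Φ_a = Σ_b P_{e⁻¹(a,b)}`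
(`P_x = tubeDWavePair`) and the staggered column current `K_a = [η, Φ_a†] = η Φ_a† - Φ_a† η`, the
triplet identity `[η, K_a] = 2 Φ_a` (the tree's `stub_columnPairTriplet`, taken here as a
HYPOTHESIS) gives, for every `η`-lowest-weight vector `ψ` (`η ψ = 0`),

  `Φ_a ψ = ½ [η, K_a] ψ = ½ (η K_a ψ - K_a η ψ) = ½ η K_a ψ`,

hence `⟨Φ_a ψ, Φ_b ψ⟩ = ¼ ⟨η K_a ψ, η K_b ψ⟩`: the pair correlator of a lowest-weight state is the
`η`-raised part of its staggered-current correlator. The two steps are pure linear algebra and are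
proved generically first:

* `mulVec_eq_half_smul_of_doubleComm` — `[η, K] = 2 Φ`, `η ψ = 0` ⟹ `Φ ψ = ½ (η K) ψ`;
* `star_dotProduct_of_eq_half_smul` — `v = ½ v'`, `w = ½ w'` ⟹ `⟨v, w⟩ = ¼ ⟨v', w'⟩`;
* `stub_pairCorrAsRaisedCurrent` — the registered stub, the two lemmas instantiated.

References: C. N. Yang, PRL 63 (1989) 2144, eqs. (4)–(6); C. N. Yang, S. C. Zhang, Mod. Phys. Lett.
B 4 (1990) 759, Theorem 1 (pseudospin multiplets; lowest-weight vectors); D. J. Scalapino, Phys. Rep.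
250 (1995) 329, §2 (the `d_{x²-y²}` pair field).
-/

noncomputable section

namespace Summit.HubbardSuperconductivity.HubbardSuperconductivity.Theorems.WidthHaldane

set_option linter.dupNamespace false -- summit = problem name (single-conjunct summit), D-0017

open scoped BigOperators Classical Matrix ComplexConjugate
open Matrix Literature.MathematicalPhysics.QuantumLattice

/-! ### Generic linear algebra: lowest-weight vectors of a doubled commutator -/

section Generic

variable {n : Type*} [Fintype n]

/-- If `[η, K] = η K - K η = 2 Φ` and `η ψ = 0`, then `Φ ψ = ½ (η K) ψ` (the `K η ψ` term dies on a
lowest-weight vector). [folklore] -/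
theorem mulVec_eq_half_smul_of_doubleComm {η K Φ : Matrix n n ℂ} {ψ : n → ℂ}
    (h : η * K - K * η = (2 : ℂ) • Φ) (hη : η *ᵥ ψ = 0) :
    Φ *ᵥ ψ = (1 / 2 : ℂ) • ((η * K) *ᵥ ψ) := by
  have h2 : (2 : ℂ) • (Φ *ᵥ ψ) = (η * K) *ᵥ ψ := by
    have := congrArg (fun A : Matrix n n ℂ => A *ᵥ ψ) h
    simp only [Matrix.sub_mulVec, Matrix.smul_mulVec, ← Matrix.mulVec_mulVec, hη,
      Matrix.mulVec_zero] at this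
    rw [← this, Matrix.mulVec_mulVec, sub_zero]
  rw [← h2, smul_smul]
  norm_num

/-- If `v = ½ v'` and `w = ½ w'` then `⟨v, w⟩ = star v ⬝ᵥ w = ¼ ⟨v', w'⟩`. [folklore] -/
theorem star_dotProduct_of_eq_half_smul {v w v' w' : n → ℂ}
    (hv : v = (1 / 2 : ℂ) • v') (hw : w = (1 / 2 : ℂ) • w') :
    star v ⬝ᵥ w = (1 / 4 : ℂ) * (star v' ⬝ᵥ w') := by
  subst hv hw
  rw [star_smul, smul_dotProduct, dotProduct_smul, smul_smul, smul_eq_mul]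
  congr 1
  rw [Complex.star_def, map_div₀, map_one, map_ofNat]
  norm_num

end Generic

/-! ### The registered stub -/

/-- **STUB `stub_pairCorrAsRaisedCurrent` of line `IdeaSketchK2` of crux `WidthHaldaneBridge`
(stmt-HubbardSuperconductivity-16311): THE PAIR CORRELATOR OF A LOWEST-WEIGHT STATE IS A RAISED
CURRENT CORRELATOR.** Given the triplet identities `[η, [η, Φ_a†]] = 2 Φ_a`, `[η†, Φ_a†] = 0` for the
column pair fields `Φ_a = Σ_b P_{e⁻¹(a,b)}` of the even tube (hypothesis; proved in the tree as
`stub_columnPairTriplet`), every vector `ψ` with `η ψ = 0` and all columns `a, b` satisfy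
`⟨Φ_a ψ, Φ_b ψ⟩ = ¼ ⟨η K_a ψ, η K_b ψ⟩`, `K_a = η Φ_a† - Φ_a† η`: instantiate
`mulVec_eq_half_smul_of_doubleComm` at `a` and at `b` and combine with
`star_dotProduct_of_eq_half_smul`. Yang–Zhang (1990) Theorem 1. [cite: YangZhang1990, Theorem 1] -/
theorem stub_pairCorrAsRaisedCurrent :
    (∀ (L M : ℕ) [NeZero L] [NeZero M], Even L → Even M →
      ∀ (Λ : Type) [LinearOrder Λ] [Fintype Λ] (e : Λ ≃ ZMod L × ZMod M) (a : ZMod L),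
        etaLower (fun x => if ((e x).1.val + (e x).2.val) % 2 = 0 then (1 : ℤˣ) else -1) *
              (etaLower (fun x => if ((e x).1.val + (e x).2.val) % 2 = 0 then (1 : ℤˣ) else -1) *
                  (∑ b : ZMod M, tubeDWavePair L M Λ e (e.symm (a, b)))ᴴ -
                (∑ b : ZMod M, tubeDWavePair L M Λ e (e.symm (a, b)))ᴴ *
                  etaLower (fun x => if ((e x).1.val + (e x).2.val) % 2 = 0 then (1 : ℤˣ) else -1)) -
            (etaLower (fun x => if ((e x).1.val + (e x).2.val) % 2 = 0 then (1 : ℤˣ) else -1) *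
                  (∑ b : ZMod M, tubeDWavePair L M Λ e (e.symm (a, b)))ᴴ -
                (∑ b : ZMod M, tubeDWavePair L M Λ e (e.symm (a, b)))ᴴ *
                  etaLower (fun x => if ((e x).1.val + (e x).2.val) % 2 = 0 then (1 : ℤˣ) else -1)) *
              etaLower (fun x => if ((e x).1.val + (e x).2.val) % 2 = 0 then (1 : ℤˣ) else -1) =
          (2 : ℂ) • ∑ b : ZMod M, tubeDWavePair L M Λ e (e.symm (a, b)) ∧
        etaRaise (fun x => if ((e x).1.val + (e x).2.val) % 2 = 0 then (1 : ℤˣ) else -1) *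
              (∑ b : ZMod M, tubeDWavePair L M Λ e (e.symm (a, b)))ᴴ -
            (∑ b : ZMod M, tubeDWavePair L M Λ e (e.symm (a, b)))ᴴ *
              etaRaise (fun x => if ((e x).1.val + (e x).2.val) % 2 = 0 then (1 : ℤˣ) else -1) = 0) →
    ∀ (L M : ℕ) [NeZero L] [NeZero M], Even L → Even M →
      ∀ (Λ : Type) [LinearOrder Λ] [Fintype Λ] (e : Λ ≃ ZMod L × ZMod M) (ψ : Fock (Orb Λ)) (a b : ZMod L),
        etaLower (fun x => if ((e x).1.val + (e x).2.val) % 2 = 0 then (1 : ℤˣ) else -1) *ᵥ ψ = 0 →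
          star ((∑ b' : ZMod M, tubeDWavePair L M Λ e (e.symm (a, b'))) *ᵥ ψ) ⬝ᵥ
              ((∑ b' : ZMod M, tubeDWavePair L M Λ e (e.symm (b, b'))) *ᵥ ψ) =
            (1 / 4 : ℂ) *
              (star ((etaLower (fun x => if ((e x).1.val + (e x).2.val) % 2 = 0 then (1 : ℤˣ) else -1) *
                  (etaLower (fun x => if ((e x).1.val + (e x).2.val) % 2 = 0 then (1 : ℤˣ) else -1) *
                      (∑ b' : ZMod M, tubeDWavePair L M Λ e (e.symm (a, b')))ᴴ -
                    (∑ b' : ZMod M, tubeDWavePair L M Λ e (e.symm (a, b')))ᴴ *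
                      etaLower (fun x => if ((e x).1.val + (e x).2.val) % 2 = 0 then (1 : ℤˣ) else -1))) *ᵥ ψ) ⬝ᵥ
                ((etaLower (fun x => if ((e x).1.val + (e x).2.val) % 2 = 0 then (1 : ℤˣ) else -1) *
                  (etaLower (fun x => if ((e x).1.val + (e x).2.val) % 2 = 0 then (1 : ℤˣ) else -1) *
                      (∑ b' : ZMod M, tubeDWavePair L M Λ e (e.symm (b, b')))ᴴ -
                    (∑ b' : ZMod M, tubeDWavePair L M Λ e (e.symm (b, b')))ᴴ *
                      etaLower (fun x => if ((e x).1.val + (e x).2.val) % 2 = 0 then (1 : ℤˣ) else -1))) *ᵥ ψ)) := by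
  intro htrip L M _ _ hL hM Λ _ _ e ψ a b hη
  obtain ⟨h2a, -⟩ := htrip L M hL hM Λ e a
  obtain ⟨h2b, -⟩ := htrip L M hL hM Λ e b
  exact star_dotProduct_of_eq_half_smul (mulVec_eq_half_smul_of_doubleComm h2a hη)
    (mulVec_eq_half_smul_of_doubleComm h2b hη)

end Summit.HubbardSuperconductivity.HubbardSuperconductivity.Theorems.WidthHaldane

end
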